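import Summits.NavierStokesRegularity.FunctionalMining.TopEigGapCutoffDeriv
import Summits.NavierStokesRegularity.FunctionalMining.TopEigCutoffPow
import HarnessLib

/-!
# FunctionalMining — L-λ(η) at a general exponent `q ≥ 2`, pointwise calculus of the cut-off fields
# `M^δ_q = H_δ(λ₁)·P₁` and `F^δ_{q,k} = H_δ(λ₁)·∂ₖλ₁`, `H_δ(s) = G_δ(s) s^{q−2}`

Search for candidate a priori estimates; no regularity claim. Cell `pub-nsfunc`, prove seat
(gen 26). The `q > 2` companion of `TopEigGapCutoffDeriv` (there `H_δ = G_δ`, `q = 2`), toward the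
dictionary's node `TopEigGapCoercivePos q η` (Proposition L-λ(η), SIEVELD §3.4b (4): "`M_q = λ₁^{q−2}M`").
With `H = cutPow δ q`, `H' = cutPowDeriv δ q` (`0 ≤ H ≤ s^{q−1}`, `0 ≤ H' ≤ (q−1)s^{q−2}`), `u₀ = topVec`,
`a_k = u₀ᵀS(∂ₖv)(x)u₀`, `A = topDiagSq`, `R = topChannelW`, at a simple point `x`:

* `cutProjPow`, `cutFluxPow`, `cutDensityPow` — the objects; GLOBAL smoothness on the class by the
  gluing lemma `isSmooth_cutRamp_topEig_mul` (`isSmooth_cutProjPow`, `isSmooth_cutFluxPow`);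
* `sum_sq_partialDeriv_cutProjPow_eq`: `∑ᵢⱼ(∂ₖM^δ_qᵢⱼ)² = (H'(λ₁)a_k)² + 2H(λ₁)²|N′ₖ|²`;
* **`sum_sq_partialDeriv_cutProjPow_le_of_gap`**: `∑ₖᵢⱼ(∂ₖM^δ_qᵢⱼ)² ≤ λ₁^{q−2}((q−1)H'A + (2/η)HR)`;
* the flux / density half (`∑ₖ∂ₖF^δ_{q,k} = H'A + H(μ + 2R)`, `cutDensityPow = 2H'A + 4HR`, and the
  pointwise comparison `∑ₖᵢⱼ(∂ₖM^δ_qᵢⱼ)² ≤ ((q−1)/(2η)) λ₁^{q−2} cutDensityPow` on the class) is the sequel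
  file `TopEigGapCutoffPowDensity`.

[ours]
-/

noncomputable section

open Filter Topology Matrix Finset MeasureTheory
open scoped ContDiff

namespace Summit.NavierStokesRegularity.FunctionalMining

open Literature.Analysis Literature.Analysis.FunctionSpaces Literature.Analysis.FunctionSpaces.Torus
  SharpClass.DirectorForm Literature.Analysis.Matrix

namespace TopEig

variable {v : UnitAddTorus (Fin 3) → EuclideanSpace ℝ (Fin 3)}

/-! ## 1. The objects and their smoothness -/

/-- **`M^δ_qᵢⱼ = H_δ(λ₁) · (topProj)ᵢⱼ`.** [ours] -/
def cutProjPow (δ q : ℝ) (v : UnitAddTorus (Fin 3) → EuclideanSpace ℝ (Fin 3)) (i j : Fin 3)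
    (x : UnitAddTorus (Fin 3)) : ℝ :=
  cutPow δ q (torusStrainTopEig v x) * topProj v x i j

/-- **`F^δ_{q,k} = H_δ(λ₁) · ∂ₖλ₁`.** [ours] -/
def cutFluxPow (δ q : ℝ) (v : UnitAddTorus (Fin 3) → EuclideanSpace ℝ (Fin 3)) (k : Fin 3)
    (x : UnitAddTorus (Fin 3)) : ℝ :=
  cutPow δ q (torusStrainTopEig v x) * Torus.partialDeriv k (torusStrainTopEig v) x

/-- **`ρ^δ_q(x) := 2 (∑ₖ ∂ₖF^δ_{q,k}(x) − H_δ(λ₁(x)) · μ(S(x); S(Δv)(x)))`.** [ours] -/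
def cutDensityPow (δ q : ℝ) (v : UnitAddTorus (Fin 3) → EuclideanSpace ℝ (Fin 3))
    (x : UnitAddTorus (Fin 3)) : ℝ :=
  2 * (∑ k, Torus.partialDeriv k (cutFluxPow δ q v k) x -
    cutPow δ q (torusStrainTopEig v x) *
      dirTopEig (StrainL4.strainFlat v x) (StrainL4.strainFlat (Torus.laplacian v) x))

/-- `λ₁ > 0` at a simple point of a divergence-free field. [ours, bookkeeping] -/
theorem topEig_pos_of_simple (hv : Torus.IsSmooth v) (hdiv : Torus.IsDivFree v)
    {x : UnitAddTorus (Fin 3)} (hx : torusStrainMidEig v x < torusStrainTopEig v x) :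
    0 < torusStrainTopEig v x := by
  obtain ⟨he1, hSe, hgap⟩ := gapForm_eigenvectorBasis hx (eigenvalues_topIndex v x)
  exact (lam_pos_of_gapForm_of_isDivFree hv hdiv he1 hSe (sub_pos.2 hx) hgap).2

/-- At a simple point of a divergence-free field, `w ↦ λ₁(x + proj w)^{q−2} · h` is chart-smooth when `h`
is. [ours, bookkeeping] -/
theorem contDiffAt_liftAt_rpow_topEig_mul (hv : Torus.IsSmooth v) (hdiv : Torus.IsDivFree v) (q : ℝ)
    {x : UnitAddTorus (Fin 3)} (hx : torusStrainMidEig v x < torusStrainTopEig v x)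
    {h : UnitAddTorus (Fin 3) → ℝ} (hh : ContDiffAt ℝ ∞ (liftAt h x) 0) :
    ContDiffAt ℝ ∞ (liftAt (fun z => torusStrainTopEig v z ^ (q - 2) * h z) x) 0 := by
  have h1 := contDiffAt_liftAt_torusStrainTopEig_of_midEig_lt hv hx
  have hne : liftAt (torusStrainTopEig v) x 0 ≠ 0 := by
    rw [liftAt_apply_zero]; exact (topEig_pos_of_simple hv hdiv hx).ne'
  exact (h1.rpow_const_of_ne (p := q - 2) hne).mul hh

/-- `M^δ_qᵢⱼ` is globally smooth on a divergence-free field of the top-gap class (`0 < η`, `δ > 0`). [ours] -/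
theorem isSmooth_cutProjPow (hv : Torus.IsSmooth v) (hdiv : Torus.IsDivFree v) (q : ℝ) {δ η : ℝ}
    (hδ : 0 < δ) (hη0 : 0 < η)
    (hgap : ∀ x : UnitAddTorus (Fin 3), torusStrainMidEig v x ≤ (1 - η) * torusStrainTopEig v x)
    (i j : Fin 3) : Torus.IsSmooth (cutProjPow δ q v i j) := by
  have e : cutProjPow δ q v i j =
      fun y => cutRamp δ (torusStrainTopEig v y) * (torusStrainTopEig v y ^ (q - 2) * topProj v y i j) := by
    funext y; simp only [cutProjPow, cutPow, mul_assoc]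
  rw [e]
  exact isSmooth_cutRamp_topEig_mul hv hδ (simple_of_le_topEig_of_gap hη0 hδ hgap) fun x hx =>
    contDiffAt_liftAt_rpow_topEig_mul hv hdiv q hx (contDiffAt_liftAt_topProj_of_simple hv hx i j)

/-- `F^δ_{q,k}` is globally smooth on a divergence-free field of the top-gap class (`0 < η`, `δ > 0`). [ours] -/
theorem isSmooth_cutFluxPow (hv : Torus.IsSmooth v) (hdiv : Torus.IsDivFree v) (q : ℝ) {δ η : ℝ}
    (hδ : 0 < δ) (hη0 : 0 < η)
    (hgap : ∀ x : UnitAddTorus (Fin 3), torusStrainMidEig v x ≤ (1 - η) * torusStrainTopEig v x)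
    (k : Fin 3) : Torus.IsSmooth (cutFluxPow δ q v k) := by
  have e : cutFluxPow δ q v k = fun y => cutRamp δ (torusStrainTopEig v y) *
      (torusStrainTopEig v y ^ (q - 2) * Torus.partialDeriv k (torusStrainTopEig v) y) := by
    funext y; simp only [cutFluxPow, cutPow, mul_assoc]
  rw [e]
  exact isSmooth_cutRamp_topEig_mul hv hδ (simple_of_le_topEig_of_gap hη0 hδ hgap) fun x hx =>
    contDiffAt_liftAt_rpow_topEig_mul hv hdiv q hx (contDiffAt_liftAt_partialDeriv_topEig_of_simple hv hx k)

/-! ## 2. The cut-off projector field at a simple point -/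

/-- Along `t ↦ x + t eₖ` through a simple point, `H_δ(λ₁)` has derivative `H_δ'(λ₁(x)) · u₀ᵀS(∂ₖv)(x)u₀`
at `0`. [ours] -/
theorem hasDerivAt_cutPow_topEig_coordLine (hv : Torus.IsSmooth v) (hdiv : Torus.IsDivFree v) (δ q : ℝ)
    {x : UnitAddTorus (Fin 3)} (hx : torusStrainMidEig v x < torusStrainTopEig v x) (k : Fin 3) :
    HasDerivAt (fun t : ℝ => cutPow δ q (torusStrainTopEig v (x + proj (t • EuclideanSpace.single k (1 : ℝ)))))
      (cutPowDeriv δ q (torusStrainTopEig v x) *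
        (topVec v x ⬝ᵥ (torusStrainMatrix (Torus.partialDeriv k v) x *ᵥ topVec v x))) 0 := by
  have h1 := hasDerivAt_topEig_coordLine hv hx (eigenvalues_topIndex v x) k
  have hpos : 0 < torusStrainTopEig v (x + proj ((0 : ℝ) • EuclideanSpace.single k (1 : ℝ))) := by
    rw [coordLine_zero]; exact topEig_pos_of_simple hv hdiv hx
  have h2 := hasDerivAt_cutPow δ q hpos
  have h := h2.comp 0 h1
  rw [coordLine_zero] at h
  exact h

/-- **`∑ᵢⱼ (∂ₖ M^δ_qᵢⱼ(x))² = (H'(λ₁)a_k)² + 2 H(λ₁)² |N′ₖ|²`** at a simple point. [ours] -/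
theorem sum_sq_partialDeriv_cutProjPow_eq (hv : Torus.IsSmooth v) (hdiv : Torus.IsDivFree v) (δ q : ℝ)
    {x : UnitAddTorus (Fin 3)} (hx : torusStrainMidEig v x < torusStrainTopEig v x) (k : Fin 3) :
    ∑ i, ∑ j, (Torus.partialDeriv k (cutProjPow δ q v i j) x) ^ 2 =
      (cutPowDeriv δ q (torusStrainTopEig v x) *
          (topVec v x ⬝ᵥ (torusStrainMatrix (Torus.partialDeriv k v) x *ᵥ topVec v x))) ^ 2 +
        2 * cutPow δ q (torusStrainTopEig v x) ^ 2 *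
          ∑ b ∈ Finset.univ.erase (topIndex v x),
            ((((torusStrainMatrix_isHermitian v x).eigenvectorBasis b).ofLp ⬝ᵥ
                (torusStrainMatrix (Torus.partialDeriv k v) x *ᵥ topVec v x)) /
              (torusStrainTopEig v x - (torusStrainMatrix_isHermitian v x).eigenvalues b)) ^ 2 := by
  obtain ⟨he1, hSe, hgap⟩ := gapForm_eigenvectorBasis hx (eigenvalues_topIndex v x)
  rw [ofLp_eigenvectorBasis_topIndex] at he1 hSe hgap
  set e : Fin 3 → ℝ := topVec v x with hedef
  set M : Matrix (Fin 3) (Fin 3) ℝ := torusStrainMatrix (Torus.partialDeriv k v) x with hMdef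
  obtain ⟨N', hder, h0, hnorm⟩ := hasDerivAt_topProj_coordLine hv hx (eigenvalues_topIndex v x) k
  rw [ofLp_eigenvectorBasis_topIndex] at hder h0 hnorm
  have hG := hasDerivAt_cutPow_topEig_coordLine hv hdiv δ q hx k
  set c : ℝ := cutPowDeriv δ q (torusStrainTopEig v x) * (e ⬝ᵥ (M *ᵥ e)) with hcdef
  set Gx : ℝ := cutPow δ q (torusStrainTopEig v x) with hGx
  have hP0 : ∀ i j, topProj v (x + proj ((0 : ℝ) • EuclideanSpace.single k (1 : ℝ))) i j = e i * e j := by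
    intro i j
    rw [coordLine_zero]
    rfl
  have hG0 : cutPow δ q (torusStrainTopEig v (x + proj ((0 : ℝ) • EuclideanSpace.single k (1 : ℝ)))) = Gx := by
    rw [coordLine_zero]
  have hpd : ∀ i j, Torus.partialDeriv k (cutProjPow δ q v i j) x =
      c * (e i * e j) + Gx * (N' i * e j + e i * N' j) := by
    intro i j
    have h := hG.mul (hder i j)
    rw [hP0 i j, hG0] at h
    exact h.deriv
  simp_rw [hpd]
  have hexp : ∀ i j, (c * (e i * e j) + Gx * (N' i * e j + e i * N' j)) ^ 2 =
      c ^ 2 * ((e i * e i) * (e j * e j)) + Gx ^ 2 * (N' i * e j + e i * N' j) ^ 2 +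
        2 * c * Gx * ((e i * N' i) * (e j * e j) + (e i * e i) * (e j * N' j)) := by
    intro i j; ring
  simp_rw [hexp, Finset.sum_add_distrib, ← Finset.mul_sum, ← Finset.sum_mul]
  have h1 : ∑ j, e j * e j = 1 := by simpa [dotProduct] using he1
  have h2 : ∑ i, e i * N' i = 0 := by simpa [dotProduct, mul_comm] using h0
  have hcross : ∑ i, ∑ j, (e i * N' i * (e j * e j) + e i * e i * (e j * N' j)) = 0 := by
    have hin : ∀ i, ∑ j, (e i * N' i * (e j * e j) + e i * e i * (e j * N' j)) =
        e i * N' i * (∑ j, e j * e j) + e i * e i * (∑ j, e j * N' j) := fun i => by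
      rw [Finset.sum_add_distrib, Finset.mul_sum, Finset.mul_sum]
    simp_rw [hin, h1, h2, mul_one, mul_zero, add_zero]
    exact h2
  rw [sum_sq_projDeriv_eq he1 h0, h1, hcross, hnorm]
  ring

/-- **`∑ₖ∑ᵢⱼ (∂ₖ M^δ_qᵢⱼ(x))² ≤ λ₁^{q−2} · ((q−1) H'(λ₁) A + (2/η) H(λ₁) R)` at a simple point of the
top-gap class** (`0 < η`, `2 ≤ q`): one factor `1/(λ₁−κ_b) ≤ 1/(ηλ₁)` per channel, `H² ≤ λ₁·λ₁^{q−2}H`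
and `H'² ≤ (q−1)λ₁^{q−2}H'`. [ours] -/
theorem sum_sq_partialDeriv_cutProjPow_le_of_gap (hv : Torus.IsSmooth v) (hdiv : Torus.IsDivFree v)
    {δ q η : ℝ} (hq : 2 ≤ q) (hη0 : 0 < η)
    {x : UnitAddTorus (Fin 3)} (hx : torusStrainMidEig v x < torusStrainTopEig v x)
    (hgapx : torusStrainMidEig v x ≤ (1 - η) * torusStrainTopEig v x) :
    ∑ k, ∑ i, ∑ j, (Torus.partialDeriv k (cutProjPow δ q v i j) x) ^ 2 ≤
      torusStrainTopEig v x ^ (q - 2) *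
        ((q - 1) * cutPowDeriv δ q (torusStrainTopEig v x) * topDiagSq v x +
          2 / η * cutPow δ q (torusStrainTopEig v x) * topChannelW v x) := by
  set lam : ℝ := torusStrainTopEig v x with hlam
  have hlam0 : 0 < lam := topEig_pos_of_simple hv hdiv hx
  set gx : ℝ := cutPowDeriv δ q lam with hgx
  set Gx : ℝ := cutPow δ q lam with hGx
  set L : ℝ := lam ^ (q - 2) with hL
  have hL0 : 0 ≤ L := Real.rpow_nonneg hlam0.le _
  have hgx0 : 0 ≤ gx := cutPowDeriv_nonneg hq hlam0
  have hGx0 : 0 ≤ Gx := cutPow_nonneg q hlam0.le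
  have hg2 : gx ^ 2 ≤ (q - 1) * L * gx := cutPowDeriv_sq_le hq hlam0
  have hG2 : Gx ^ 2 ≤ lam * L * Gx := cutPow_sq_le' q hlam0
  have hk : ∀ k : Fin 3, ∑ i, ∑ j, (Torus.partialDeriv k (cutProjPow δ q v i j) x) ^ 2 ≤
      L * ((q - 1) * gx * (topVec v x ⬝ᵥ (torusStrainMatrix (Torus.partialDeriv k v) x *ᵥ topVec v x)) ^ 2) +
        L * (2 / η * Gx * ∑ b ∈ Finset.univ.erase (topIndex v x),
          (((torusStrainMatrix_isHermitian v x).eigenvectorBasis b).ofLp ⬝ᵥ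
              (torusStrainMatrix (Torus.partialDeriv k v) x *ᵥ topVec v x)) ^ 2 /
            (lam - (torusStrainMatrix_isHermitian v x).eigenvalues b)) := by
    intro k
    rw [sum_sq_partialDeriv_cutProjPow_eq hv hdiv δ q hx k]
    set a : ℝ := topVec v x ⬝ᵥ (torusStrainMatrix (Torus.partialDeriv k v) x *ᵥ topVec v x) with hadef
    have hW : ∑ b ∈ Finset.univ.erase (topIndex v x),
        ((((torusStrainMatrix_isHermitian v x).eigenvectorBasis b).ofLp ⬝ᵥ
            (torusStrainMatrix (Torus.partialDeriv k v) x *ᵥ topVec v x)) /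
          (lam - (torusStrainMatrix_isHermitian v x).eigenvalues b)) ^ 2 ≤
        (η * lam)⁻¹ * ∑ b ∈ Finset.univ.erase (topIndex v x),
          (((torusStrainMatrix_isHermitian v x).eigenvectorBasis b).ofLp ⬝ᵥ
              (torusStrainMatrix (Torus.partialDeriv k v) x *ᵥ topVec v x)) ^ 2 /
            (lam - (torusStrainMatrix_isHermitian v x).eigenvalues b) := by
      rw [Finset.mul_sum]
      refine Finset.sum_le_sum fun b hb => ?_
      have hne : b ≠ topIndex v x := (Finset.mem_erase.1 hb).1
      have hle := eigenvalues_le_midEig_of_ne hx (eigenvalues_topIndex v x) hne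
      set cb : ℝ := ((torusStrainMatrix_isHermitian v x).eigenvectorBasis b).ofLp ⬝ᵥ
        (torusStrainMatrix (Torus.partialDeriv k v) x *ᵥ topVec v x)
      set gap : ℝ := lam - (torusStrainMatrix_isHermitian v x).eigenvalues b with hgapdef
      have hga : η * lam ≤ gap := by rw [hgapdef]; nlinarith
      have hηl : 0 < η * lam := mul_pos hη0 hlam0
      have hgap0 : 0 < gap := lt_of_lt_of_le hηl hga
      rw [div_pow, sq gap, ← div_div, div_eq_mul_inv (cb ^ 2 / gap), mul_comm (cb ^ 2 / gap)]
      exact mul_le_mul_of_nonneg_right (inv_anti₀ hηl hga) (div_nonneg (sq_nonneg _) hgap0.le)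
    set Rk : ℝ := ∑ b ∈ Finset.univ.erase (topIndex v x),
      (((torusStrainMatrix_isHermitian v x).eigenvectorBasis b).ofLp ⬝ᵥ
          (torusStrainMatrix (Torus.partialDeriv k v) x *ᵥ topVec v x)) ^ 2 /
        (lam - (torusStrainMatrix_isHermitian v x).eigenvalues b) with hRk
    have hRk0 : 0 ≤ Rk := Finset.sum_nonneg fun b hb => by
      have hle := eigenvalues_le_midEig_of_ne hx (eigenvalues_topIndex v x) (Finset.ne_of_mem_erase hb)
      exact div_nonneg (sq_nonneg _) (by linarith)
    -- (H' a)² ≤ (q−1) L H' a²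
    have hdiag : (gx * a) ^ 2 ≤ L * ((q - 1) * gx * a ^ 2) := by
      rw [mul_pow]
      have := mul_le_mul_of_nonneg_right hg2 (sq_nonneg a)
      calc gx ^ 2 * a ^ 2 ≤ (q - 1) * L * gx * a ^ 2 := this
        _ = L * ((q - 1) * gx * a ^ 2) := by ring
    -- 2 H² W ≤ L (2/η) H R
    have hchan : 2 * Gx ^ 2 * ∑ b ∈ Finset.univ.erase (topIndex v x),
        ((((torusStrainMatrix_isHermitian v x).eigenvectorBasis b).ofLp ⬝ᵥ
            (torusStrainMatrix (Torus.partialDeriv k v) x *ᵥ topVec v x)) /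
          (lam - (torusStrainMatrix_isHermitian v x).eigenvalues b)) ^ 2 ≤ L * (2 / η * Gx * Rk) := by
      have h1 : 2 * Gx ^ 2 * ∑ b ∈ Finset.univ.erase (topIndex v x),
          ((((torusStrainMatrix_isHermitian v x).eigenvectorBasis b).ofLp ⬝ᵥ
              (torusStrainMatrix (Torus.partialDeriv k v) x *ᵥ topVec v x)) /
            (lam - (torusStrainMatrix_isHermitian v x).eigenvalues b)) ^ 2 ≤
          2 * Gx ^ 2 * ((η * lam)⁻¹ * Rk) := mul_le_mul_of_nonneg_left hW (by positivity)
      have h2 : 2 * Gx ^ 2 * ((η * lam)⁻¹ * Rk) ≤ 2 * (lam * L * Gx) * ((η * lam)⁻¹ * Rk) :=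
        mul_le_mul_of_nonneg_right (mul_le_mul_of_nonneg_left hG2 (by norm_num))
          (mul_nonneg (inv_nonneg.2 (mul_pos hη0 hlam0).le) hRk0)
      have e : 2 * (lam * L * Gx) * ((η * lam)⁻¹ * Rk) = L * (2 / η * Gx * Rk) := by
        have hl : lam ≠ 0 := hlam0.ne'
        field_simp
      linarith
    exact add_le_add hdiag hchan
  have hsum : ∑ k : Fin 3, (L * ((q - 1) * gx *
          (topVec v x ⬝ᵥ (torusStrainMatrix (Torus.partialDeriv k v) x *ᵥ topVec v x)) ^ 2) +
        L * (2 / η * Gx * ∑ b ∈ Finset.univ.erase (topIndex v x),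
          (((torusStrainMatrix_isHermitian v x).eigenvectorBasis b).ofLp ⬝ᵥ
              (torusStrainMatrix (Torus.partialDeriv k v) x *ᵥ topVec v x)) ^ 2 /
            (lam - (torusStrainMatrix_isHermitian v x).eigenvalues b))) =
      L * ((q - 1) * gx * topDiagSq v x + 2 / η * Gx * topChannelW v x) := by
    unfold topDiagSq topChannelW
    rw [Finset.sum_add_distrib, ← Finset.mul_sum, ← Finset.mul_sum, ← Finset.mul_sum, ← Finset.mul_sum]
    ring
  exact (Finset.sum_le_sum fun k _ => hk k).trans hsum.le

end TopEig

end Summit.NavierStokesRegularity.FunctionalMining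

end
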